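import Summits.Ventures.PercRepro0.DisjOcc
import Summits.Ventures.PercRepro0.TrifCreate

/-!
# R_MID-6 · INTEGRATED-BUBBLE on `Defs` (seat p4, block-M census supplement, part 2; BK as an explicit hypothesis)

The Lean twin of PLAN-plan-1-v4 §3 (census v5 §3.2) (i)–(v), on the definitions module, with P10 · BK as the
named hypothesis `Bubble.BK d` (module DisjOcc: never proved here):

* `bubble d p` = the bubble diagram `B_p = Σ_x τ_p(0,x)²` (extended real; `bubble_mono` = (i), monotone in `p`);
* **(ii)** `sum_P_piv_le` / `ofReal_dtau_le`: `Σ_{e ∈ E(Λ_n)} P_p(e pivotal for {0 ↔_{Λ_n} x}) ≤ 2d · B_p`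
  (pivotal decomposition + BK, `2ab ≤ a² + b²`, each vertex has `≤ 2d` neighbours, F2), i.e. `d/dq τ^n_q(0,x) ≤ 2d B_q`
  with the derivative given by Russo's formula (`hasDerivAt_tauBox`);
* **(iii)** `ofReal_sub_le_lintegral` (finite volume, fundamental theorem of calculus on `[a, b] ⊆ [0, 1]`) and
  `ofReal_tau_sub_le_lintegral` (`n → ∞`): `τ_b(0,x) − τ_a(0,x) ≤ 2d ∫_a^b B_q dq`;
* **(iv)** `ofReal_theta_sq_le`: `θ_d(p_c(d))² ≤ 2d ∫_p^{p_c(d)} B_q dq` for `p ∈ [0, p_c(d))`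
  (H4 `θ² ≤ τ_{p_c}(0,x)` with P3 from `TrifCreate.P3_Unique_all`, then `τ_p(0,x) → 0` below `p_c` by L2);
* **(v) the door** `T_of_integrable_bubble`: `∫_{p₀}^{p_c(d)} B_q dq < ∞` for some `p₀ ∈ [0, p_c(d))` ⇒ `T d`
  (continuity from above of the measure with density `B` along `(p_c − δ/(k+1), p_c] ↓ {p_c}`).

The integral is the Lebesgue integral (`∫⁻`, value in `[0, ∞]`) of `q ↦ B_{clamp q}` over `(a, b]`; all
statements are for `d ≥ 1` and assume `BK d`. NOTHING here asserts the hypothesis of (v) for any `d`: the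
census puts the obstruction exactly there (no upper bound on `B_q` as `q ↑ p_c(d)` is on file for any
`3 ≤ d ≤ 10`). Census evidence only, off every declaration path; nothing claimed on `T(d)` for any `d`.
-/

namespace Summit.Ventures.PercRepro0.Bubble

open MeasureTheory ProbabilityTheory unitInterval Set Filter
open Summit.Ventures.PercRepro0.Defs
open Summit.Ventures.PercRepro0.Sharp
open scoped ENNReal NNReal Topology Classical

variable {d : ℕ}

/-! ### The bubble diagram and the counting bound -/

/-- The bubble diagram `B_p = Σ_x τ_p(0,x)²` (an extended real; `∞` allowed). -/
noncomputable def bubble (d : ℕ) (p : I) : ℝ≥0∞ :=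
  ∑' x : Vertex d, (P d p {ω : Config d | Conn d ω 0 x}) ^ 2

/-- `p ↦ B_p` is non-decreasing (L1 on the increasing events `{0 ↔ x}`). -/
theorem bubble_mono : Monotone (bubble d) := fun p q hpq =>
  ENNReal.tsum_le_tsum fun x =>
    ENNReal.pow_le_pow_left (L1_Monotone_holds d p q hpq _ (isUpperSet_conn 0 x) (measurableSet_conn 0 x))

/-- AM–GM in `ℝ≥0∞` for finite values: `2ab ≤ a² + b²`. -/
theorem two_mul_mul_le_sq_add_sq {a b : ℝ≥0∞} (ha : a ≠ ⊤) (hb : b ≠ ⊤) :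
    2 * (a * b) ≤ a ^ 2 + b ^ 2 := by
  lift a to ℝ≥0 using ha
  lift b to ℝ≥0 using hb
  have h : (2 : ℝ) * a * b ≤ (a : ℝ) ^ 2 + (b : ℝ) ^ 2 := two_mul_le_add_sq (a : ℝ) b
  have h' : (2 : ℝ≥0) * (a * b) ≤ a ^ 2 + b ^ 2 := by
    rw [← NNReal.coe_le_coe]
    push_cast
    linarith
  exact_mod_cast h'

/-- The ordered nearest-neighbour pairs inside `Λ_n`. -/
noncomputable def obonds (d n : ℕ) : Finset (Vertex d × Vertex d) :=
  (boxF d n ×ˢ boxF d n).filter fun uv => (lattice d).Adj uv.1 uv.2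

/-- Membership in `obonds`. -/
theorem mem_obonds {n : ℕ} {uv : Vertex d × Vertex d} :
    uv ∈ obonds d n ↔ (uv.1 ∈ box d n ∧ uv.2 ∈ box d n) ∧ (lattice d).Adj uv.1 uv.2 := by
  rw [obonds, Finset.mem_filter, Finset.mem_product, mem_boxF, mem_boxF]

/-- An ordered pair of `obonds` gives a bond of `Λ_n`. -/
theorem mk_mem_boxBondsF {n : ℕ} {uv : Vertex d × Vertex d} (h : uv ∈ obonds d n) :
    s(uv.1, uv.2) ∈ boxBondsF d n := by
  rw [mem_boxBondsF]
  obtain ⟨⟨h1, h2⟩, hadj⟩ := mem_obonds.1 h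
  refine ⟨hadj, fun v hv => ?_⟩
  rw [Sym2.mem_iff] at hv
  rcases hv with rfl | rfl
  · exact h1
  · exact h2

/-- Every vertex has at most `2d` neighbours. -/
theorem card_nbrs_le (x : Vertex d) : (nbrs x).card ≤ 2 * d := by
  refine Finset.card_image_le.trans ?_
  simp [Finset.card_univ, Fintype.card_prod, Fintype.card_fin, Fintype.card_bool, mul_comm]

/-- Summing a function of the first coordinate over the ordered pairs of `Λ_n` costs at most `2d` per vertex. -/
theorem sum_obonds_fst_le (n : ℕ) (h : Vertex d → ℝ≥0∞) :
    ∑ uv ∈ obonds d n, h uv.1 ≤ 2 * d * ∑ u ∈ boxF d n, h u := by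
  rw [obonds, Finset.sum_filter, Finset.sum_product, Finset.mul_sum]
  refine Finset.sum_le_sum fun u _ => ?_
  rw [← Finset.sum_filter]
  have hsub : (boxF d n).filter (fun v => (lattice d).Adj u v) ⊆ nbrs u := by
    intro v hv
    rw [Finset.mem_filter] at hv
    exact mem_nbrs.2 hv.2
  have hcard : ((((boxF d n).filter fun v => (lattice d).Adj u v).card : ℕ) : ℝ≥0∞) ≤ 2 * d := by
    calc ((((boxF d n).filter fun v => (lattice d).Adj u v).card : ℕ) : ℝ≥0∞)
        ≤ ((nbrs u).card : ℝ≥0∞) := by exact_mod_cast Finset.card_le_card hsub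
      _ ≤ 2 * d := by exact_mod_cast card_nbrs_le u
  calc ∑ v ∈ (boxF d n).filter (fun v => (lattice d).Adj u v), h (u, v).1
      ≤ ((boxF d n).filter fun v => (lattice d).Adj u v).card • h u :=
        Finset.sum_le_card_nsmul _ _ _ fun _ _ => le_rfl
    _ = ((((boxF d n).filter fun v => (lattice d).Adj u v).card : ℕ) : ℝ≥0∞) * h u := nsmul_eq_mul _ _
    _ ≤ 2 * d * h u := mul_le_mul_left hcard _

/-- The same for the second coordinate. -/
theorem sum_obonds_snd_le (n : ℕ) (h : Vertex d → ℝ≥0∞) :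
    ∑ uv ∈ obonds d n, h uv.2 ≤ 2 * d * ∑ v ∈ boxF d n, h v := by
  rw [obonds, Finset.sum_filter, Finset.sum_product_right, Finset.mul_sum]
  refine Finset.sum_le_sum fun v _ => ?_
  rw [← Finset.sum_filter]
  have hsub : (boxF d n).filter (fun u => (lattice d).Adj u v) ⊆ nbrs v := by
    intro u hu
    rw [Finset.mem_filter] at hu
    exact mem_nbrs.2 hu.2.symm
  have hcard : ((((boxF d n).filter fun u => (lattice d).Adj u v).card : ℕ) : ℝ≥0∞) ≤ 2 * d := by
    calc ((((boxF d n).filter fun u => (lattice d).Adj u v).card : ℕ) : ℝ≥0∞)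
        ≤ ((nbrs v).card : ℝ≥0∞) := by exact_mod_cast Finset.card_le_card hsub
      _ ≤ 2 * d := by exact_mod_cast card_nbrs_le v
  calc ∑ u ∈ (boxF d n).filter (fun u => (lattice d).Adj u v), h (u, v).2
      ≤ ((boxF d n).filter fun u => (lattice d).Adj u v).card • h v :=
        Finset.sum_le_card_nsmul _ _ _ fun _ _ => le_rfl
    _ = ((((boxF d n).filter fun u => (lattice d).Adj u v).card : ℕ) : ℝ≥0∞) * h v := nsmul_eq_mul _ _
    _ ≤ 2 * d * h v := mul_le_mul_left hcard _

/-- `Σ_{u ∈ Λ_n} τ(0,u)² ≤ B_p`. -/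
theorem sum_sq_le_bubble (p : I) (n : ℕ) :
    ∑ u ∈ boxF d n, (P d p {ω : Config d | Conn d ω 0 u}) ^ 2 ≤ bubble d p :=
  ENNReal.sum_le_tsum _

/-- `P_p(v ↔ x) = P_p(0 ↔ x − v)` (F2). -/
theorem P_conn_eq_sub (p : I) (v x : Vertex d) :
    P d p {ω : Config d | Conn d ω v x} = P d p {ω : Config d | Conn d ω 0 (x - v)} := by
  have h := P_shiftConfig_preimage v p (measurableSet_conn (0 : Vertex d) (x - v))
  rw [preimage_shiftConfig_conn, zero_add, sub_add_cancel] at h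
  exact h

/-- `Σ_{v ∈ Λ_n} τ(v,x)² ≤ B_p`. -/
theorem sum_sq_snd_le_bubble (p : I) (n : ℕ) (x : Vertex d) :
    ∑ v ∈ boxF d n, (P d p {ω : Config d | Conn d ω v x}) ^ 2 ≤ bubble d p := by
  have hinj : Set.InjOn (fun v : Vertex d => x - v) ↑(boxF d n) :=
    fun a _ b _ hab => sub_right_injective hab
  calc ∑ v ∈ boxF d n, (P d p {ω : Config d | Conn d ω v x}) ^ 2
      = ∑ v ∈ boxF d n, (P d p {ω : Config d | Conn d ω 0 (x - v)}) ^ 2 := by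
        refine Finset.sum_congr rfl fun v _ => ?_
        rw [P_conn_eq_sub]
    _ = ∑ w ∈ (boxF d n).image (fun v => x - v), (P d p {ω : Config d | Conn d ω 0 w}) ^ 2 := by
        rw [Finset.sum_image hinj]
    _ ≤ bubble d p := ENNReal.sum_le_tsum _

/-- **The counting bound** (PLAN-plan-1-v4 §3 (ii), measure form, given BK):
`Σ_{e ∈ E(Λ_n)} P_p(e pivotal for {0 ↔_{Λ_n} x}) ≤ 2d · B_p`. -/
theorem sum_P_piv_le (hBK : BK d) (p : I) (n : ℕ) (x : Vertex d) :
    ∑ e ∈ boxBondsF d n, P d p (Russo.Piv e (boxConn d n 0 x)) ≤ 2 * d * bubble d p := by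
  classical
  set G : Vertex d × Vertex d → ℝ≥0∞ := fun uv =>
    (P d p {ω : Config d | Conn d ω 0 uv.1}) ^ 2 + (P d p {ω : Config d | Conn d ω uv.2 x}) ^ 2 with hG
  -- each bond is bounded by its two orientations
  have hfib : ∀ e ∈ boxBondsF d n, 2 * P d p (Russo.Piv e (boxConn d n 0 x)) ≤
      ∑ uv ∈ (obonds d n).filter (fun uv => s(uv.1, uv.2) = e), G uv := by
    intro e he
    induction e using Sym2.ind with
    | _ a b =>
      have hab : (lattice d).Adj a b := by
        have h := (mem_boxBondsF.1 he).1
        exact ((lattice d).mem_edgeSet).1 h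
      have hne : a ≠ b := (lattice d).ne_of_adj hab
      have hbox : ∀ v ∈ s(a, b), v ∈ box d n := (mem_boxBondsF.1 he).2
      have hpair : ({(a, b), (b, a)} : Finset (Vertex d × Vertex d)) ⊆
          (obonds d n).filter (fun uv => s(uv.1, uv.2) = s(a, b)) := by
        intro uv huv
        rw [Finset.mem_insert, Finset.mem_singleton] at huv
        rw [Finset.mem_filter, mem_obonds]
        rcases huv with rfl | rfl
        · exact ⟨⟨⟨hbox a (Sym2.mem_mk_left a b), hbox b (Sym2.mem_mk_right a b)⟩, hab⟩, rfl⟩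
        · exact ⟨⟨⟨hbox b (Sym2.mem_mk_right a b), hbox a (Sym2.mem_mk_left a b)⟩, hab.symm⟩, Sym2.eq_swap⟩
      have hne' : ((a, b) : Vertex d × Vertex d) ≠ (b, a) := fun h => hne (Prod.mk.inj h).1
      calc 2 * P d p (Russo.Piv s(a, b) (boxConn d n 0 x))
          ≤ 2 * (P d p {ω : Config d | Conn d ω 0 a} * P d p {ω : Config d | Conn d ω b x} +
              P d p {ω : Config d | Conn d ω 0 b} * P d p {ω : Config d | Conn d ω a x}) :=
            mul_le_mul_right (P_piv_le hBK p n x a b) 2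
        _ = 2 * (P d p {ω : Config d | Conn d ω 0 a} * P d p {ω : Config d | Conn d ω b x}) +
              2 * (P d p {ω : Config d | Conn d ω 0 b} * P d p {ω : Config d | Conn d ω a x}) := by
            rw [mul_add]
        _ ≤ G (a, b) + G (b, a) :=
            add_le_add (two_mul_mul_le_sq_add_sq (measure_ne_top _ _) (measure_ne_top _ _))
              (two_mul_mul_le_sq_add_sq (measure_ne_top _ _) (measure_ne_top _ _))
        _ = ∑ uv ∈ ({(a, b), (b, a)} : Finset (Vertex d × Vertex d)), G uv := by
            rw [Finset.sum_pair hne']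
        _ ≤ ∑ uv ∈ (obonds d n).filter (fun uv => s(uv.1, uv.2) = s(a, b)), G uv :=
            Finset.sum_le_sum_of_subset hpair
  have hmaps : ∀ uv ∈ obonds d n, s(uv.1, uv.2) ∈ boxBondsF d n := fun uv huv => mk_mem_boxBondsF huv
  have h2 : 2 * ∑ e ∈ boxBondsF d n, P d p (Russo.Piv e (boxConn d n 0 x)) ≤
      2 * (2 * d * bubble d p) := by
    calc 2 * ∑ e ∈ boxBondsF d n, P d p (Russo.Piv e (boxConn d n 0 x))
        = ∑ e ∈ boxBondsF d n, 2 * P d p (Russo.Piv e (boxConn d n 0 x)) := by rw [Finset.mul_sum]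
      _ ≤ ∑ e ∈ boxBondsF d n, ∑ uv ∈ (obonds d n).filter (fun uv => s(uv.1, uv.2) = e), G uv :=
          Finset.sum_le_sum hfib
      _ = ∑ uv ∈ obonds d n, G uv := Finset.sum_fiberwise_of_maps_to hmaps G
      _ = ∑ uv ∈ obonds d n, (P d p {ω : Config d | Conn d ω 0 uv.1}) ^ 2 +
            ∑ uv ∈ obonds d n, (P d p {ω : Config d | Conn d ω uv.2 x}) ^ 2 := by
          rw [hG, Finset.sum_add_distrib]
      _ ≤ 2 * d * ∑ u ∈ boxF d n, (P d p {ω : Config d | Conn d ω 0 u}) ^ 2 +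
            2 * d * ∑ v ∈ boxF d n, (P d p {ω : Config d | Conn d ω v x}) ^ 2 :=
          add_le_add (sum_obonds_fst_le n _) (sum_obonds_snd_le n _)
      _ ≤ 2 * d * bubble d p + 2 * d * bubble d p :=
          add_le_add (mul_le_mul_right (sum_sq_le_bubble p n) _)
            (mul_le_mul_right (sum_sq_snd_le_bubble p n x) _)
      _ = 2 * (2 * d * bubble d p) := by ring
  exact (ENNReal.mul_le_mul_iff_right two_ne_zero ENNReal.ofNat_ne_top).1 h2

/-! ### Russo's formula for `τ^n` and the integrated bound (PLAN-plan-1-v4 §3 (ii)–(iii)) -/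

/-- The Russo derivative of `r ↦ τ^n_{clamp r}(0,x)`: the sum over the bonds of `Λ_n` of the pivotal probabilities. -/
noncomputable def dtau (n : ℕ) (x : Vertex d) (q : ℝ) : ℝ :=
  ∑ e ∈ boxBondsF d n, (P d (clamp q) (Russo.Piv e (boxConn d n 0 x))).toReal

/-- Russo's formula for `τ^n(0,x)` (SHARP Lemma 1.3, `Russo.hasDerivAt_P`). -/
theorem hasDerivAt_tauBox (n : ℕ) (x : Vertex d) {q : ℝ} (hq0 : 0 < q) (hq1 : q < 1) :
    HasDerivAt (fun r : ℝ => (P d (clamp r) (boxConn d n 0 x)).toReal) (dtau n x q) q :=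
  Russo.hasDerivAt_P q hq0 hq1 (boxBondsF_subset_bonds n) (determinedBy_boxConn_boxBondsF n 0 x)
    (isUpperSet_boxConn n 0 x)

/-- `0 ≤ dtau`. -/
theorem dtau_nonneg (n : ℕ) (x : Vertex d) (q : ℝ) : 0 ≤ dtau n x q :=
  Finset.sum_nonneg fun _ _ => ENNReal.toReal_nonneg

/-- `q ↦ dtau n x q` is continuous (finitely determined events). -/
theorem continuous_dtau (n : ℕ) (x : Vertex d) : Continuous (dtau n x) := by
  unfold dtau
  refine continuous_finsetSum _ fun e _ => ?_
  have hfin : ((↑(boxBondsF d n) : Set (Sym2 (Vertex d))) \ {e}).Finite :=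
    (boxBondsF d n).finite_toSet.subset Set.sdiff_subset
  have hdet := Russo.determinedBy_piv (determinedBy_boxConn_boxBondsF n 0 x) e
  exact continuous_setBernoulli_clamp_of_determinedBy (bonds d) hfin
    (Russo.measurableSet_of_determinedBy hfin hdet) hdet

/-- (ii) in derivative form (given BK): `dtau n x q ≤ 2d · B_{clamp q}` as extended reals. -/
theorem ofReal_dtau_le (hBK : BK d) (n : ℕ) (x : Vertex d) (q : ℝ) :
    ENNReal.ofReal (dtau n x q) ≤ 2 * d * bubble d (clamp q) := by
  unfold dtau
  rw [ENNReal.ofReal_sum_of_nonneg fun _ _ => ENNReal.toReal_nonneg]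
  calc ∑ e ∈ boxBondsF d n, ENNReal.ofReal (P d (clamp q) (Russo.Piv e (boxConn d n 0 x))).toReal
      = ∑ e ∈ boxBondsF d n, P d (clamp q) (Russo.Piv e (boxConn d n 0 x)) :=
        Finset.sum_congr rfl fun e _ => ENNReal.ofReal_toReal (measure_ne_top _ _)
    _ ≤ 2 * d * bubble d (clamp q) := sum_P_piv_le hBK (clamp q) n x

/-- (iii) in finite volume: for `0 ≤ a ≤ b ≤ 1`,
`τ^n_b(0,x) − τ^n_a(0,x) ≤ 2d ∫_a^b B_q dq` (fundamental theorem of calculus on `[a, b]`). -/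
theorem ofReal_sub_le_lintegral (hBK : BK d) (n : ℕ) (x : Vertex d) {a b : ℝ} (ha : 0 ≤ a) (hab : a ≤ b)
    (hb : b ≤ 1) :
    ENNReal.ofReal ((P d (clamp b) (boxConn d n 0 x)).toReal - (P d (clamp a) (boxConn d n 0 x)).toReal) ≤
      ∫⁻ q in Set.Ioc a b, 2 * d * bubble d (clamp q) := by
  have hcont : Continuous fun r : ℝ => (P d (clamp r) (boxConn d n 0 x)).toReal := continuous_tau_box n 0 x
  have hderiv : ∀ q ∈ Set.Ioo a b,
      HasDerivAt (fun r : ℝ => (P d (clamp r) (boxConn d n 0 x)).toReal) (dtau n x q) q :=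
    fun q hq => hasDerivAt_tauBox n x (lt_of_le_of_lt ha hq.1) (lt_of_lt_of_le hq.2 hb)
  have hint : IntervalIntegrable (dtau n x) volume a b := (continuous_dtau n x).intervalIntegrable a b
  have hftc : ∫ q in a..b, dtau n x q = (P d (clamp b) (boxConn d n 0 x)).toReal -
      (P d (clamp a) (boxConn d n 0 x)).toReal :=
    intervalIntegral.integral_eq_sub_of_hasDerivAt_of_le hab hcont.continuousOn hderiv hint
  rw [← hftc, intervalIntegral.integral_of_le hab,
    ofReal_integral_eq_lintegral_ofReal ((continuous_dtau n x).integrableOn_Ioc)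
      (Filter.Eventually.of_forall (dtau_nonneg n x))]
  exact lintegral_mono fun q => ofReal_dtau_le hBK n x q

/-- **(iii)** (PLAN-plan-1-v4 §3, given BK): for `0 ≤ a ≤ b ≤ 1` and every `x`,
`τ_b(0,x) − τ_a(0,x) ≤ 2d ∫_a^b B_q dq` — the finite-volume bound passed to `n → ∞`. -/
theorem ofReal_tau_sub_le_lintegral (hBK : BK d) (x : Vertex d) {a b : ℝ} (ha : 0 ≤ a) (hab : a ≤ b)
    (hb : b ≤ 1) :
    ENNReal.ofReal (tau d (clamp b) 0 x - tau d (clamp a) 0 x) ≤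
      ∫⁻ q in Set.Ioc a b, 2 * d * bubble d (clamp q) := by
  have h1 := tendsto_P_boxConn (d := d) (clamp b) 0 x
  have h2 := tendsto_P_boxConn (d := d) (clamp a) 0 x
  have h3 : Tendsto (fun n : ℕ => ENNReal.ofReal ((P d (clamp b) (boxConn d n 0 x)).toReal -
      (P d (clamp a) (boxConn d n 0 x)).toReal)) atTop
      (𝓝 (ENNReal.ofReal (tau d (clamp b) 0 x - tau d (clamp a) 0 x))) :=
    (ENNReal.continuous_ofReal.tendsto _).comp (h1.sub h2)
  exact le_of_tendsto' h3 fun n => ofReal_sub_le_lintegral hBK n x ha hab hb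

/-! ### The door (PLAN-plan-1-v4 §3 (iv)–(v)) -/

/-- **(iv)** (given BK; P3 supplied by `TrifCreate.P3_Unique_all`, `d ≥ 1`): for every `p ∈ [0, p_c(d))`,
`θ_d(p_c(d))² ≤ 2d ∫_p^{p_c(d)} B_q dq` (as extended reals) — `θ(p_c)² ≤ τ_{p_c}(0,x)` (H4), (iii), and
`τ_p(0,x) → 0` as `x → ∞` below `p_c` (L2). -/
theorem ofReal_theta_sq_le (hd : 1 ≤ d) (hBK : BK d) {p : ℝ} (hp0 : 0 ≤ p) (hp : p < pc d) :
    ENNReal.ofReal (theta d (pc d) ^ 2) ≤ ∫⁻ q in Set.Ioc p (pc d), 2 * d * bubble d (clamp q) := by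
  have hP3 : P3_Unique d := TrifCreate.P3_Unique_all d
  have hθτ : ∀ x : Vertex d, theta d (pc d) ^ 2 ≤ tau d (clamp (pc d)) 0 x :=
    fun x => HighD.thetaI_sq_le_tau_of_P3 d (clamp (pc d)) x hP3
  have hx : ∀ x : Vertex d, ENNReal.ofReal (theta d (pc d) ^ 2 - tau d (clamp p) 0 x) ≤
      ∫⁻ q in Set.Ioc p (pc d), 2 * d * bubble d (clamp q) := fun x =>
    (ENNReal.ofReal_le_ofReal (by linarith [hθτ x])).trans
      (ofReal_tau_sub_le_lintegral hBK x hp0 hp.le (pc_le_one hd))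
  have h0 : thetaI d (clamp p) = 0 := theta_eq_zero_of_lt_pc hd hp0 hp
  have htau : Tendsto (fun x : Vertex d => tau d (clamp p) 0 x) cofinite (𝓝 0) :=
    TwoPoint.tendsto_tau_cofinite_of_thetaI_eq_zero hd (clamp p) h0
  have htend : Tendsto (fun x : Vertex d => ENNReal.ofReal (theta d (pc d) ^ 2 - tau d (clamp p) 0 x))
      cofinite (𝓝 (ENNReal.ofReal (theta d (pc d) ^ 2 - 0))) :=
    (ENNReal.continuous_ofReal.tendsto _).comp (tendsto_const_nhds.sub htau)
  haveI : Infinite (Vertex d) := HighD.infinite_vertex d hd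
  rw [sub_zero] at htend
  exact le_of_tendsto' htend hx

/-- **(v) THE DOOR — R_MID-6 · INTEGRATED-BUBBLE** (given BK; `d ≥ 1`): if `∫_{p₀}^{p_c(d)} B_q dq < ∞` for some
`p₀ ∈ [0, p_c(d))`, then `T d`, i.e. `θ_d(p_c(d)) = 0`. Nothing is asserted about the hypothesis for any `d`. -/
theorem T_of_integrable_bubble (hd : 1 ≤ d) (hBK : BK d) {p₀ : ℝ} (hp₀ : 0 ≤ p₀) (hp₀c : p₀ < pc d)
    (hfin : ∫⁻ q in Set.Ioc p₀ (pc d), bubble d (clamp q) < ⊤) : T d := by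
  set μ : Measure ℝ := volume.withDensity fun q => bubble d (clamp q) with hμ
  set δ : ℝ := pc d - p₀ with hδ
  have hδpos : 0 < δ := sub_pos.2 hp₀c
  set s : ℕ → Set ℝ := fun k => Set.Ioc (pc d - δ / (k + 1)) (pc d) with hs
  have hk_nonneg : ∀ k : ℕ, 0 ≤ pc d - δ / (k + 1) := fun k => by
    have : δ / (k + 1) ≤ δ := div_le_self hδpos.le (by linarith [(Nat.cast_nonneg k : (0 : ℝ) ≤ k)])
    linarith
  have hk_lt : ∀ k : ℕ, pc d - δ / (k + 1) < pc d := fun k => by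
    have : 0 < δ / (k + 1) := div_pos hδpos (by linarith [(Nat.cast_nonneg k : (0 : ℝ) ≤ k)])
    linarith
  have hs_meas : ∀ k, NullMeasurableSet (s k) μ := fun _ => measurableSet_Ioc.nullMeasurableSet
  have hs_anti : Antitone s := fun j k hjk => by
    refine Set.Ioc_subset_Ioc_left ?_
    have hjk' : (j : ℝ) + 1 ≤ (k : ℝ) + 1 := by exact_mod_cast Nat.succ_le_succ hjk
    have : δ / (k + 1) ≤ δ / (j + 1) :=
      div_le_div_of_nonneg_left hδpos.le (by linarith [(Nat.cast_nonneg j : (0 : ℝ) ≤ j)]) hjk'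
    linarith
  have hs0 : μ (s 0) ≠ ⊤ := by
    have h0 : s 0 = Set.Ioc p₀ (pc d) := by
      simp only [hs, Nat.cast_zero, zero_add, div_one, hδ, sub_sub_cancel]
    rw [h0, hμ, withDensity_apply _ measurableSet_Ioc]
    exact hfin.ne
  have hinter : μ (⋂ k, s k) = 0 := by
    have hsub : (⋂ k, s k) ⊆ {pc d} := by
      intro q hq
      rw [Set.mem_iInter] at hq
      rw [Set.mem_singleton_iff]
      by_contra hne
      have hqlt : q < pc d := lt_of_le_of_ne (hq 0).2 hne
      have hε : 0 < (pc d - q) / δ := div_pos (sub_pos.2 hqlt) hδpos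
      obtain ⟨k, hk⟩ := exists_nat_one_div_lt hε
      have h1 : δ / (k + 1) < pc d - q := by
        have := mul_lt_mul_of_pos_left hk hδpos
        rw [mul_div_cancel₀ _ hδpos.ne'] at this
        calc δ / (k + 1) = δ * (1 / (k + 1)) := by ring
          _ < pc d - q := this
      have h2 := (hq k).1
      linarith
    refine measure_mono_null hsub ?_
    rw [hμ, withDensity_apply _ (measurableSet_singleton _), lintegral_singleton, Real.volume_singleton,
      mul_zero]
  have hlim : Tendsto (μ ∘ s) atTop (𝓝 0) := by
    rw [← hinter]
    exact tendsto_measure_iInter_atTop hs_meas hs_anti ⟨0, hs0⟩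
  have hbound : ∀ k : ℕ, ENNReal.ofReal (theta d (pc d) ^ 2) ≤ 2 * d * (μ ∘ s) k := fun k => by
    show ENNReal.ofReal (theta d (pc d) ^ 2) ≤ 2 * d * μ (s k)
    rw [hμ, withDensity_apply _ measurableSet_Ioc,
      ← lintegral_const_mul' _ _ (ENNReal.mul_ne_top ENNReal.ofNat_ne_top (ENNReal.natCast_ne_top d))]
    exact ofReal_theta_sq_le hd hBK (hk_nonneg k) (hk_lt k)
  have hlim2 : Tendsto (fun k : ℕ => 2 * d * (μ ∘ s) k) atTop (𝓝 0) := by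
    have := ENNReal.Tendsto.const_mul (a := 2 * d) hlim
      (Or.inr (ENNReal.mul_ne_top ENNReal.ofNat_ne_top (ENNReal.natCast_ne_top d)))
    rwa [mul_zero] at this
  have hθ : ENNReal.ofReal (theta d (pc d) ^ 2) ≤ 0 := ge_of_tendsto' hlim2 hbound
  have hsq : theta d (pc d) ^ 2 ≤ 0 := ENNReal.ofReal_eq_zero.1 (le_antisymm hθ bot_le)
  show theta d (pc d) = 0
  nlinarith [theta_nonneg d (pc d), sq_nonneg (theta d (pc d))]

/-- The door in the paper's form (`p₀ ∈ (0, p_c(d))`): a one-line instance of `T_of_integrable_bubble`. -/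
theorem T_of_integrable_bubble_of_pos (hd : 1 ≤ d) (hBK : BK d) {p₀ : ℝ} (hp₀ : 0 < p₀) (hp₀c : p₀ < pc d)
    (hfin : ∫⁻ q in Set.Ioc p₀ (pc d), bubble d (clamp q) < ⊤) : T d :=
  T_of_integrable_bubble hd hBK hp₀.le hp₀c hfin

end Summit.Ventures.PercRepro0.Bubble
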